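import Literature.MathematicalPhysics.QuantumFieldTheory.Balaban1983to89.B15Prop1Carrier
import Literature.MathematicalPhysics.QuantumFieldTheory.Balaban1983to89.B15Sect1InstancesB

/-!
# `Balaban1983to89.B15Prop1CarrierStdB` — [Balaban1989LargeFieldI] (= [B15]) Proposition 1 p. 194: PRINT'S INSTANCE OF THE CARRIER OVER A **BOND-LEVEL SOLUTION MAP**
# `bg : DetBackgroundB P G av` AND A **BOND-DATUM FAMILY** `bd` — `Inst.stdB ∕ InstOn.stdB` := `B15Prop1Carrier.Inst.std ∕ InstOn.std` (§9 ∕ §10) with the function (1.77)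
# `B15Sect1Instances.fun177stdB bg M₁ bd Z k` for `fun177std bg M₁ Z k`; the instances of record ARE the instance `(bg.toDetBackground, genSetDatumP)` by `rfl`

statement-level skeleton of published theorems with citation tags; proofs where landed; nothing here is a claim about the
Yang–Mills mass gap

Cell `pub-ymgap` (HUMAN RULINGS D-0062 ∕ D-0149), lane `pub-ymgap-dag-n12-c` g34 (R134 seat (a), N12 = [B15], s1); `--kind definition --supports` K1⁹ `stmt-QuantumFields-27364`;
count-neutral.  (E1) variant (iii-b), N12 re-attachment step 3 of the lane's memo `N12-REATTACHMENT-DESIGN-2026-08-30.md` §3 (lit-balaban iface-1 g179 ∕ lead g40: NO OBJECTION to this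
module as a NEW additive file; `B15Prop1Carrier` UNTOUCHED).  STATEMENT-ONLY (two definitions + `rfl` ∕ `Iff.rfl`); the «minimal orbit» theorems over the [15] (181) covariance
(`stdB_f_gaugeAct`, `IsMinPt.stdB_gaugeAct`, `isMinimum_stdB_iff_forall`, `isMinimumOn_stdB_iff_forall`) live in the sibling THEOREMS-ONLY module `B15Prop1CarrierStdBBridges`.

HONESTY GUARD (director-ym №338 (5)).  PURELY ADDITIVE: the carrier `Inst ∕ lfVar ∕ InstOn ∕ lfVarOn ∕ Prop1Printed` is ABSTRACT in the function `f` and is NOT twinned; only print's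
INSTANCE `Inst.std ∕ InstOn.std` is parametrised (FLAG №16 ∕ LOCATE-HSEAM 5d3298b8d191f169); the (b)-instances stay landed and true on their own text and remain the declarations of
record on SKELETON row B15.Prop1; NOTHING in `B15Prop1Carrier` is edited; `Inst.std bg.toDetBackground M₁ … = Inst.stdB bg M₁ genSetDatumP …` and the `InstOn` edition are `rfl`.

WHAT IS HERE (STATEMENT-ONLY).
* §1 `Inst.stdB bg M₁ bd Z Λ k M An := ⟨k, Z, Λ, M, fun177stdB bg M₁ bd Z k, An⟩`; `Inst.stdB_f` (`rfl`); `Inst.std_toDetBackground` (`rfl`); `isMinPt_stdB_iff` (*"a minimum of the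
  function"* at the instance IS `IsVLambdaStdB`, `Iff.rfl`).
* §2 `InstOn.stdB … M a₁ An := ⟨Inst.stdB …, domReg Z k a₁⟩` (print's example domain *"|∂V_k − 1| < a₁ on Z"*, datum-free, reused); `InstOn.stdB_f ∕ InstOn.stdB_dom` (`rfl`);
  `InstOn.std_toDetBackground` (`rfl`).

HONEST SCOPE.  Definitions + `rfl` bookkeeping; nothing of Bałaban's analysis asserted or proved; `B15.Prop1Printed` NOT inhabited here; count-neutral; N12 NOT discharged; K0⁷ ∕ K1⁹ NOT
closed; one finite 𝕋⁴ programme at fixed ε — nothing continuum ∕ ℝ⁴ ∕ OS; the Yang–Mills mass gap (Clay) is NOT proved by any of this.  No `instance`, no `notation`, no `sorry`.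

References: [B15] = [Balaban1989LargeFieldI] (1.74) p.192, (1.77)–(1.78) Prop. 1 p.194, (1.79) p.195; [Balaban1989LargeFieldII] pp.358–359; [II] = [Balaban1984PropagatorsII] (2.3) p.224;
[I] = [Balaban1987RG1] (0.1) p.251; [III] = [Balaban1988Convergent] (2.12)–(2.13) pp.256–257.
-/

noncomputable section

open Set

namespace Literature.MathematicalPhysics.QuantumFieldTheory.Balaban1983to89.B15Prop1Carrier

open Literature.MathematicalPhysics.QuantumFieldTheory.Balaban1983to89
open B15DeterminingSets B15DeterminingSetsB B14.Eq213DetSet B14.Eq216Concrete B8Eq17ClassAkV1 GaugeField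
open Literature.MathematicalPhysics.QuantumFieldTheory.BalabanImbrieJaffe1984to88.BIJ85Eq453GaugeField
open B16Sect1Backgrounds B14.Eq12InteriorLocality B15Sect1Instances B15Eq177GaugeInvariance

variable {P : Params}

/-! ## §1  Print's instance of the carrier over `(bg : DetBackgroundB, bd)` -/

section StdB

variable {G : Type} [GaugeGroup G] {𝔤 : Type*} [AddCommGroup 𝔤] [Module ℝ 𝔤] {av : ∀ j, Averaging P j G}
  (bg : DetBackgroundB P G av) (M₁ : ℕ) (bd : ℕ → (ℕ → Set (Site P 0)) → BDetSet P)

/-- **PRINT'S INSTANCE of Proposition 1's data OVER A BOND-LEVEL SOLUTION MAP AND A BOND-DATUM FAMILY**: step `k`, regions `Z ⊇ Λ`, cube size `M`, THE FUNCTION (1.77)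
`V_k ↦ A(U_{k,Z}(V_k))` = `B15Sect1Instances.fun177stdB bg M₁ bd Z k` ((1.74) over `(bg, bd k (maxDomT M₁ Z))`), and the carried analytic-extension clause `An` — `Inst.std` with
`fun177stdB` for `fun177std`.  Reading (b): `bd := genSetDatumP` (`Inst.std_toDetBackground`); print's [II] (2.3): `bd := lamDatumP`. [cite: Balaban1989LargeFieldI, (1.77) p.194; Balaban1984PropagatorsII, (2.3) p.224] -/
def Inst.stdB (Z Λ : Set (Site P 0)) (k : ℕ) (M : ℝ) (An : ℝ → GaugeField P k G → Prop) : Inst P G :=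
  ⟨k, Z, Λ, M, fun177stdB bg M₁ bd Z k, An⟩

/-- The function of print's instance over `(bg, bd)` is `fun177stdB` (definitional). [cite: Balaban1989LargeFieldI, (1.77) p.194] -/
@[simp] theorem Inst.stdB_f (Z Λ : Set (Site P 0)) (k : ℕ) (M : ℝ) (An : ℝ → GaugeField P k G → Prop) :
    (Inst.stdB bg M₁ bd Z Λ k M An).f = fun177stdB bg M₁ bd Z k := rfl

/-- **THE INSTANCE OF RECORD**: `Inst.std` at the pulled-back site-level map IS `Inst.stdB` at reading (b)'s family — `rfl`. [cite: Balaban1989LargeFieldI, Prop. 1 p.194; Balaban1987RG1, (0.1) p.251] -/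
theorem Inst.std_toDetBackground (Z Λ : Set (Site P 0)) (k : ℕ) (M : ℝ) (An : ℝ → GaugeField P k G → Prop) :
    Inst.std bg.toDetBackground M₁ Z Λ k M An = Inst.stdB bg M₁ genSetDatumP Z Λ k M An := rfl

/-- At print's instance over `(bg, bd)` *"a minimum of the function"* IS `IsVLambdaStdB bg M₁ bd Z Λ k V_k V_Λ` (definitional). [cite: Balaban1989LargeFieldI, Prop. 1 (1.78) p.194] -/
theorem isMinPt_stdB_iff (Z Λ : Set (Site P 0)) (k : ℕ) (Vk VΛ : GaugeField P k G) :
    IsMinPt (bondsOf (pts k Λ)) (fun177stdB bg M₁ bd Z k) Vk VΛ ↔ IsVLambdaStdB bg M₁ bd Z Λ k Vk VΛ := Iff.rfl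

/-! ## §2  The same with print's example domain of (1.77) -/

/-- **PRINT'S INSTANCE WITH ITS EXAMPLE DOMAIN, OVER `(bg, bd)`**: `Inst.stdB bg M₁ bd Z Λ k M An` with `dom := domReg Z k a₁` (*"|∂V_k − 1| < a₁ on Z"*, datum-free) — `InstOn.std` with
`fun177stdB` for `fun177std`. [cite: Balaban1989LargeFieldI, (1.77) p.194; Balaban1984PropagatorsII, (2.3) p.224] -/
def InstOn.stdB (Z Λ : Set (Site P 0)) (k : ℕ) (M a₁ : ℝ) (An : ℝ → GaugeField P k G → Prop) : InstOn P G :=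
  ⟨Inst.stdB bg M₁ bd Z Λ k M An, domReg Z k a₁⟩

/-- The function of print's instance with domain over `(bg, bd)` is `fun177stdB` (definitional). [cite: Balaban1989LargeFieldI, (1.77) p.194] -/
@[simp] theorem InstOn.stdB_f (Z Λ : Set (Site P 0)) (k : ℕ) (M a₁ : ℝ) (An : ℝ → GaugeField P k G → Prop) :
    (InstOn.stdB bg M₁ bd Z Λ k M a₁ An).f = fun177stdB bg M₁ bd Z k := rfl

/-- Its domain is `domReg Z k a₁` (definitional). [cite: Balaban1989LargeFieldI, (1.77) p.194] -/
@[simp] theorem InstOn.stdB_dom (Z Λ : Set (Site P 0)) (k : ℕ) (M a₁ : ℝ) (An : ℝ → GaugeField P k G → Prop) :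
    (InstOn.stdB bg M₁ bd Z Λ k M a₁ An).dom = domReg Z k a₁ := rfl

/-- **THE INSTANCE OF RECORD (with domain)**: `InstOn.std` at the pulled-back map IS `InstOn.stdB` at reading (b)'s family — `rfl`. [cite: Balaban1989LargeFieldI, (1.77) p.194; Balaban1987RG1, (0.1) p.251] -/
theorem InstOn.std_toDetBackground (Z Λ : Set (Site P 0)) (k : ℕ) (M a₁ : ℝ) (An : ℝ → GaugeField P k G → Prop) :
    InstOn.std bg.toDetBackground M₁ Z Λ k M a₁ An = InstOn.stdB bg M₁ genSetDatumP Z Λ k M a₁ An := rfl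

end StdB

end Literature.MathematicalPhysics.QuantumFieldTheory.Balaban1983to89.B15Prop1Carrier

end
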